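import Mathlib
import Summits.CriticalPhenomena.Ising3DConformalLimit.Theorems.PrecisionLaplacianEtaBoundsTransferLimit
import HarnessLib

/-!
# The infinite-volume equation `A₀ G − a ∗ G = δ` (no defect)

Helper file for item `stmt-CriticalPhenomena-4804`
(`Summit.CriticalPhenomena.Ising3DConformalLimit.Theses.PrecisionLaplacian.EtaBoundsTransfer`), part of its
unconditional proof: potential theory of inverse M-matrices ⇒ infinite-volume equation and Green-function
representation; Fourier analysis on `[-π,π]^d` ⇒ block-sum upper bounds; quadratic test function ⇒ ball-sum
lower bounds; Messager–Miracle-Solé ⇒ pointwise two-sided power bounds. No definitions are introduced: the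
objects (kernel matrices, box sequences, convolution powers) enter through defining hypotheses.
-/

namespace Summit.CriticalPhenomena.Ising3DConformalLimit.Theorems.EtaBoundsTransfer

open Matrix Finset Filter Topology Literature.Probability.LatticeModels
open scoped NNReal

section Equation

variable {d : ℕ} {G : Site d → ℝ} {M : (A : Finset (Site d)) → Matrix A A ℝ}
  {k : ℕ → ℝ} {t : ℕ → Site d → ℝ} {a : Site d → ℝ}

/-- **Finite-volume row identity along boxes**: for `z ∈ Λ_n`,
`k n · G z − ∑_{y ∈ Λ_n ∖ 0} t n y · G (z − y) = [z = 0]`. -/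
theorem box_row_identity
    (hM : ∀ A, M A = Matrix.of fun (p q : ↥A) => G (q.1 - p.1))
    (hSP : ∀ A : Finset (Site d), (M A).PosDef ∧
      ∀ u v : ↥A, (u ≠ v → (M A)⁻¹ u v ≤ 0) ∧ 0 ≤ ∑ w, (M A)⁻¹ u w)
    (hk : ∀ n, k n = (M (box d n))⁻¹ ⟨0, zero_mem_box d n⟩ ⟨0, zero_mem_box d n⟩)
    (ht : ∀ n y (hy : y ∈ box d n), t n y = -(M (box d n))⁻¹ ⟨0, zero_mem_box d n⟩ ⟨y, hy⟩)
    {n : ℕ} {z : Site d} (hz : z ∈ box d n) :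
    k n * G z - ∑ y ∈ (box d n).erase 0, t n y * G (z - y) = if z = 0 then 1 else 0 := by
  have hid := sum_inv_mul_apply hM hSP (box d n) ⟨0, zero_mem_box d n⟩ ⟨z, hz⟩
  have h2 : ∀ w : ↥(box d n), (M (box d n))⁻¹ ⟨0, zero_mem_box d n⟩ w = -t n w.1 := by
    intro w; rw [ht n w.1 w.2, neg_neg]
  simp only [h2] at hid
  have h1 : ∑ w : ↥(box d n), -t n w.1 * G (z - w.1) = ∑ y ∈ box d n, -t n y * G (z - y) :=
    Finset.sum_coe_sort (box d n) (fun y => -t n y * G (z - y))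
  rw [h1, ← Finset.add_sum_erase _ _ (zero_mem_box d n), t_zero hk ht n] at hid
  have hiff : ((⟨0, zero_mem_box d n⟩ : ↥(box d n)) = ⟨z, hz⟩) ↔ z = 0 := by
    rw [Subtype.mk_eq_mk]; exact eq_comm
  simp only [hiff] at hid
  rw [← hid]
  simp only [neg_neg, sub_zero, neg_mul, Finset.sum_neg_distrib]
  ring

/-- **The infinite-volume equation** `A₀ G(z) − ∑_y a'(y) G(z − y) = δ_{z,0}`: the finite-volume
row identities pass to the limit along boxes with no defect, because the off-diagonal masses
`∑ t n ≤ A₀` are uniformly bounded and `G → 0` at infinity (tightness), while `t n → a`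
pointwise and `k n → A₀`. -/
theorem limit_equation
    (hM : ∀ A, M A = Matrix.of fun (p q : ↥A) => G (q.1 - p.1))
    (hSP : ∀ A : Finset (Site d), (M A).PosDef ∧
      ∀ u v : ↥A, (u ≠ v → (M A)⁻¹ u v ≤ 0) ∧ 0 ≤ ∑ w, (M A)⁻¹ u w)
    (hGto : Tendsto G cofinite (𝓝 0))
    (hk : ∀ n, k n = (M (box d n))⁻¹ ⟨0, zero_mem_box d n⟩ ⟨0, zero_mem_box d n⟩)
    (ht : ∀ n y (hy : y ∈ box d n), t n y = -(M (box d n))⁻¹ ⟨0, zero_mem_box d n⟩ ⟨y, hy⟩)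
    (ha : ∀ y, a y = ⨅ A : {A : Finset (Site d) // (0 : Site d) ∈ A ∧ y ∈ A},
      -((M A.1)⁻¹ ⟨0, A.2.1⟩ ⟨y, A.2.2⟩))
    {A₀ : ℝ} (hkA : Tendsto k atTop (𝓝 A₀)) (hkle : ∀ n, k n ≤ A₀) (z : Site d) :
    A₀ * G z - ∑' y, (if y = 0 then 0 else a y) * G (z - y) = if z = 0 then 1 else 0 := by
  set a' : Site d → ℝ := fun y => if y = 0 then 0 else a y with ha'
  have hG0 := apply_zero_pos hM hSP
  have hA0 : 0 < A₀ := lt_of_lt_of_le (lt_of_lt_of_le (by positivity) (k_ge hM hSP hk 0)) (hkle 0)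
  have hGnn : ∀ u, 0 ≤ G u := apply_nonneg hM hSP
  have hGle : ∀ u, G u ≤ G 0 := fun u => by
    by_cases hu : u = 0
    · rw [hu]
    · exact (apply_lt_apply_zero hM hSP hu).le
  have ha'nn : ∀ y, 0 ≤ a' y := fun y => by
    simp only [ha']; split_ifs with h
    · exact le_rfl
    · exact a_nonneg hSP ha h
  obtain ⟨hsa, hsa_le⟩ := summable_a hSP hk ht ha hkle
  -- the limit object `L = ∑' a'(y) G(z-y)`
  have hsumm : Summable (fun y => a' y * G (z - y)) :=
    Summable.of_nonneg_of_le (fun y => mul_nonneg (ha'nn y) (hGnn _))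
      (fun y => mul_le_mul_of_nonneg_left (hGle _) (ha'nn y)) (hsa.mul_right (G 0))
  set L := ∑' y, a' y * G (z - y) with hL
  set S : ℕ → ℝ := fun n => ∑ y ∈ (box d n).erase 0, t n y * G (z - y) with hS
  -- Step 1: `S n → L`
  have hSL : Tendsto S atTop (𝓝 L) := by
    rw [Metric.tendsto_atTop]
    intro ε hε
    set ε' := ε / 4 / A₀ with hε'
    have hε'pos : 0 < ε' := by positivity
    have hε'A : ε' * A₀ = ε / 4 := by rw [hε']; field_simp
    -- `G(z - y) < ε'` outside a box `Λ_R`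
    have hfin : {u : Site d | ε' ≤ G u}.Finite := by
      have hev : ∀ᶠ u in cofinite, G u < ε' := hGto.eventually (gt_mem_nhds hε'pos)
      have := Filter.eventually_cofinite.1 hev
      simpa [not_lt] using this
    obtain ⟨R, hR⟩ := exists_subset_box' (d := d) (hfin.toFinset.image fun u => z - u)
    have hsmall : ∀ y, y ∉ box d R → G (z - y) < ε' := by
      intro y hy
      by_contra hge
      rw [not_lt] at hge
      apply hy
      apply hR
      refine Finset.mem_image.2 ⟨z - y, hfin.mem_toFinset.2 hge, ?_⟩
      abel
    -- the finite part converges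
    set P : ℕ → ℝ := fun n => ∑ y ∈ (box d R).erase 0, t n y * G (z - y) with hP
    set Pinf : ℝ := ∑ y ∈ (box d R).erase 0, a y * G (z - y) with hPinf
    have hPt : Tendsto P atTop (𝓝 Pinf) := by
      apply tendsto_finsetSum
      intro y hy
      exact (tendsto_t hM hSP ht ha (Finset.mem_erase.1 hy).1).mul_const _
    obtain ⟨N₁, hN₁⟩ := Metric.tendsto_atTop.1 hPt (ε / 4) (by positivity)
    -- the tail of `L`
    have hPinf_eq : ∑ y ∈ (box d R).erase 0, a' y * G (z - y) = Pinf := by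
      refine Finset.sum_congr rfl fun y hy => ?_
      rw [ha']; simp only [if_neg (Finset.mem_erase.1 hy).1]
    have htailL : |L - Pinf| ≤ ε / 4 := by
      have hsplit := hsumm.sum_add_tsum_compl (s := (box d R).erase 0)
      rw [hPinf_eq] at hsplit
      set Sc : Set (Site d) := ((((box d R).erase 0 : Finset (Site d)) : Set (Site d))ᶜ) with hSc
      have hT : L - Pinf = ∑' y : Sc, a' y * G (z - y) := by
        rw [hL, ← hsplit]; ring
      rw [hT]
      have hTnn : 0 ≤ ∑' y : Sc, a' y * G (z - y) :=
        tsum_nonneg fun y => mul_nonneg (ha'nn _) (hGnn _)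
      rw [abs_of_nonneg hTnn]
      have hpt : ∀ y : Sc, a' y * G (z - y) ≤ ε' * a' y := by
        intro y
        by_cases hy0 : (y : Site d) = 0
        · simp [ha', hy0]
        · have hy2 : (y : Site d) ∉ (box d R).erase 0 := by
            have h2 : (y : Site d) ∈ ((((box d R).erase 0 : Finset (Site d)) : Set (Site d))ᶜ) := y.2
            exact fun h => ((Set.mem_compl_iff _ _).1 h2) (Finset.mem_coe.2 h)
          have hyR : (y : Site d) ∉ box d R := fun h => hy2 (Finset.mem_erase.2 ⟨hy0, h⟩)
          have := hsmall y hyR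
          nlinarith [ha'nn y, this]
      calc ∑' y : Sc, a' y * G (z - y)
          ≤ ∑' y : Sc, ε' * a' y :=
            (hsumm.subtype _).tsum_le_tsum hpt ((hsa.mul_left ε').subtype _)
        _ = ε' * ∑' y : Sc, a' y := by rw [tsum_mul_left]
        _ ≤ ε' * ∑' y, a' y := by
            apply mul_le_mul_of_nonneg_left _ hε'pos.le
            exact Summable.tsum_subtype_le _ _ ha'nn hsa
        _ ≤ ε' * A₀ := mul_le_mul_of_nonneg_left hsa_le hε'pos.le
        _ = ε / 4 := hε'A
    refine ⟨max N₁ R, fun n hn => ?_⟩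
    have hnN : N₁ ≤ n := le_trans (le_max_left _ _) hn
    have hnR : R ≤ n := le_trans (le_max_right _ _) hn
    -- the tail of `S n`
    have hsub : (box d R).erase 0 ⊆ (box d n).erase 0 :=
      Finset.erase_subset_erase 0 (box_mono d hnR)
    have hSsplit : S n = P n + ∑ y ∈ (box d n).erase 0 \ (box d R).erase 0, t n y * G (z - y) := by
      rw [hS, hP]; simp only
      rw [← Finset.sum_sdiff hsub]; ring
    have htnn : ∀ y ∈ (box d n).erase 0, 0 ≤ t n y := fun y hy =>
      t_nonneg hSP ht (Finset.mem_erase.1 hy).1 (Finset.mem_of_mem_erase hy)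
    have htailS : |S n - P n| ≤ ε / 4 := by
      rw [hSsplit, add_sub_cancel_left]
      have hnn : 0 ≤ ∑ y ∈ (box d n).erase 0 \ (box d R).erase 0, t n y * G (z - y) :=
        Finset.sum_nonneg fun y hy => mul_nonneg (htnn y (Finset.mem_sdiff.1 hy).1) (hGnn _)
      rw [abs_of_nonneg hnn]
      calc ∑ y ∈ (box d n).erase 0 \ (box d R).erase 0, t n y * G (z - y)
          ≤ ∑ y ∈ (box d n).erase 0 \ (box d R).erase 0, t n y * ε' := by
            apply Finset.sum_le_sum
            intro y hy
            have hy1 := (Finset.mem_sdiff.1 hy).1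
            have hy2 := (Finset.mem_sdiff.1 hy).2
            have hy0 : y ≠ 0 := (Finset.mem_erase.1 hy1).1
            have hyR : y ∉ box d R := fun h => hy2 (Finset.mem_erase.2 ⟨hy0, h⟩)
            exact mul_le_mul_of_nonneg_left (hsmall y hyR).le (htnn y hy1)
        _ ≤ ∑ y ∈ (box d n).erase 0, t n y * ε' := by
            apply Finset.sum_le_sum_of_subset_of_nonneg Finset.sdiff_subset
            intro y hy _
            exact mul_nonneg (htnn y hy) hε'pos.le
        _ = ε' * ∑ y ∈ (box d n).erase 0, t n y := by rw [← Finset.sum_mul]; ring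
        _ ≤ ε' * k n := mul_le_mul_of_nonneg_left (sum_t_le_k hSP hk ht n) hε'pos.le
        _ ≤ ε' * A₀ := mul_le_mul_of_nonneg_left (hkle n) hε'pos.le
        _ = ε / 4 := hε'A
    have hmid : |P n - Pinf| < ε / 4 := by
      have := hN₁ n hnN
      rwa [Real.dist_eq] at this
    rw [Real.dist_eq]
    calc |S n - L| = |(S n - P n) + (P n - Pinf) + (Pinf - L)| := by ring_nf
      _ ≤ |S n - P n| + |P n - Pinf| + |Pinf - L| := abs_add_three _ _ _
      _ < ε / 4 + ε / 4 + ε / 4 := by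
          have : |Pinf - L| ≤ ε / 4 := by rw [abs_sub_comm]; exact htailL
          linarith
      _ < ε := by linarith
  -- Step 2: the finite-volume identity is eventually constant
  have hconst : ∀ᶠ n in atTop, k n * G z - S n = if z = 0 then 1 else 0 := by
    filter_upwards [eventually_ge_atTop (Site.supNorm z)] with n hn
    exact box_row_identity hM hSP hk ht (mem_box_iff_supNorm_le.2 hn)
  have hlim : Tendsto (fun n => k n * G z - S n) atTop (𝓝 (A₀ * G z - L)) :=
    (hkA.mul_const _).sub hSL
  have hlim' : Tendsto (fun n => k n * G z - S n) atTop (𝓝 (if z = 0 then 1 else 0)) :=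
    tendsto_const_nhds.congr' (EventuallyEq.symm hconst)
  exact tendsto_nhds_unique hlim hlim'

end Equation

end Summit.CriticalPhenomena.Ising3DConformalLimit.Theorems.EtaBoundsTransfer
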